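import Summits.HodgeConjecture.HodgeConjecture.Theorems.F0P6aModuliDatumDefsDatum   -- ★ previous part of the same Lines workfile `F0_P6a_ModuliDatumDefs` (size-lint split ×4)
import HarnessLib

/-!
# `F0P6aModuliDatumDefs` — ★ RE-HOME of `Lines/F0_P6a_ModuliDatumDefs.lean`, PART 4 of 4 (size-lint split; cut at a declaration boundary).

See PART 1 `Theorems/F0P6aModuliDatumDefsReadings.lean` for the full re-home header and the original module docstring (verbatim there). Namespaces and sections KEPT
(re-opened below exactly as they stand at the cut, with their `open`∕`variable` lines replayed); code bytes = the workfile՚s, docstrings included; options preamble repeated from PART 1.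
HC_CM is proved only modulo the 7 printed citations (2 remaining: hLiu418 = stmt-HodgeConjecture-24832, h413 = stmt-HodgeConjecture-24833) until rung 0 closes; a re-home is count-neutral. -/

namespace Summit.HodgeConjecture.HodgeConjecture.Cruxes.HLiu418.F0P6aModuliDatumDefs
set_option linter.dupNamespace false  -- `Summit.HodgeConjecture.HodgeConjecture.…` BY DESIGN (D-0017)
open CategoryTheory NumberField IsDedekindDomain MulAction
open scoped Matrix
open Literature.NumberTheory.GaloisRepresentations
open Literature.NumberTheory.Automorphic Literature.NumberTheory.Automorphic.UnitaryGroup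
open Literature.AlgebraicGeometry.ShimuraVarieties.UnitaryCanonicalModel
open Literature.NumberTheory.Automorphic.Liu2021.AppendixC
open Literature.AlgebraicGeometry.Motives (AlgPoints IntegralModel frobeniusOver SchemeOver thickening thickeningGalAction thickeningLift)
open Literature.NumberTheory.DiophantineGeometry (geomResidueField specialFibreFunctor)
open Literature.AlgebraicGeometry.RelativeSpec (ActionOver)
open Literature.NumberTheory.EllipticCurves (genericFibre)
open AlgebraicGeometry (QuasiCompact QuasiSeparated LocallyOfFinitePresentation Flat IsSeparated SmoothOfRelativeDimension)
open Summit.HodgeConjecture.HodgeConjecture.Cruxes.HLiu418.F0P6cIsogenyDictionary (PointDictionary)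
open scoped Pointwise
open scoped MonoidalCategory Polynomial
open Literature.AlgebraicGeometry.Motives (specOver relFrobeniusOver frobeniusTwistOver frobSpec)
open Literature.AlgebraicGeometry.GroupSchemes.AffineGroupScheme (Alg quotIncl)
open Summit.HodgeConjecture.HodgeConjecture.Cruxes.HLiu418.F0P6cDictConstructors (kerFI AdmSub IdealIsEtale)


set_option maxHeartbeats 400000 in
/-- **`ModuliDatum … Kc G 𝓜 w hw h𝓨 θ e`** — the MODULI DATUM at MH՚s inner binders (LAYER (i), see the module docstring; layer (ii) appended before
ED. 3 is boxed).  Carriers: `Line y` = the `q+1` lines of `𝒢_y[ϖ](Ω)` (`𝒢_y` := the ONE-dimensional block of `𝒜_y[p^∞]`, placed at layer (ii)), `Sub x̄` = the `𝒪_F`-stable closed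
subgroup schemes of order `N w` of `𝒢_x̄[ϖ]`; `kerF x̄` the Frobenius kernel; `IsEtale`; READINGS `quotΩ y L` = the right-`t₁`-translate picked by `L`
(D4, LEAD M-14 (4)), `translΩ` = the `t₂`-translate, `quot` ∕ `transl` their special counterparts, `sp` = schematic closure then special fibre; LAWS (c1)
`hecke` (the DICT՚s field type token for token), (c2) `red_quotΩ` ∕ `red_translΩ`; TWIST `smap` + `smap_kerF` ∕ `quot_smap` (transport along `θ(γ,1)_s`; `isEtale_smap_iff` ∕ `transl_act` of v0.1–v0.4 dropped at v0.5, M-17r: no reader).  READING (K-TEST «t₁», ★ `recip_cmPoint_mem_doubleCoset_heckeElementAt` p845445; LEAD M-16 (2)): the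
right-`t₁(w)`-translate is the index-`q` SUBlattice at `w` of the `w`-Hom-lattice, i.e. the ROOF NEIGHBOUR `𝒜_{quotΩ y L} ≅ (𝒜_y ∕ (H_L ⊕ N)) ⊗_{𝒪_F} 𝔭_w` (quasi-isogeny
`c⁻¹q`, `N` = the `H_L^⊥`-position, helper `RoofΩ`; NOT the bare quotient, ref1 n30∕e-9) picked by a line `L` of the `c•w`-side block; `k = 0` at every frame place.  A `Type`-valued record; NOTHING is asserted by declaring it.
[cite: HarrisTaylorAMS2001, §III.4, pp. 108–110] [cite: RapoportSmithlingZhang2020Diagonal, §4.1 p. 17, pp. 20–21] [cite: Liu2021, Prop. D.8 p. 135, pp. 136–138] -/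
structure ModuliDatum (F : Type) [Field F] [NumberField F] [IsCMField F] (ι₁ : F →+* ℂ)
    (Jstar : Matrix (Fin 2) (Fin 2) F)
    (K₀ : C5.OpenCompactSubgroup ↥(finAdelic ↥(maximalRealSubfield F) F (IsCMField.complexConj F) 2 Jstar))
    (S : RecordSystemGS F Jstar ι₁ K₀) (hU7ₛ : S.HeckeTranslateDefinedOver)
    (hJ : (Jstar.map (IsCMField.complexConj F))ᵀ = Jstar) (hJu : IsUnit Jstar)
    (Fi : Type) [Field Fi] [Algebra F Fi] (Kc : C5.SmallLevel K₀) (G : Type) [Group G]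
    (𝓜 : IntegralModel (𝓞 F) F ((thickening F Fi).obj (S.M.obj Kc)))
    (w : HeightOneSpectrum (𝓞 F)) (hw : (IsCMField.complexConj F) • w ≠ w) (h𝓨 : (𝓜.localise w).IsSmoothProper 1)
    (θ : ActionOver (𝓜.localise w).total.hom ((Fi ≃ₐ[F] Fi) × G))
    (e : Fi →ₐ[F] AlgebraicClosure (w.adicCompletion F)) where
  /-- D2-Ω: the lines at a generic point `y` (in print: the `q+1` `𝒪_F`-stable lines of `𝒢_y[ϖ](Ω)`). -/
  Line : AlgPoints (S.M.obj Kc) (AlgebraicClosure (w.adicCompletion F)) → Type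
  /-- D2-κ̄: the order-`N w` subgroup schemes at a special point `x̄ ∈ P₀` (in print: of `𝒢_x̄[ϖ]`). -/
  Sub : AlgPoints (𝓜.localise w).reductionAt (geomResidueField w) → Type
  /-- D3: the Frobenius kernel `ker (F_q | 𝒢_x̄) ∈ Sub x̄`. -/
  kerF : ∀ xbar, Sub xbar
  /-- D3: the étale members of `Sub x̄`. -/
  IsEtale : ∀ {xbar}, Sub xbar → Prop
  /-- D4: the READING of the right-`t₁(w)`-translate picked by the line `L` of the `c•w`-side block (index-`q` sublattice at `w`; = the moduli quotient `A ↦ A ∕ (H_L + K_{w̄})` at layer (ii), M-16 (2); K-TEST «t₁» ★ p845445). -/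
  quotΩ : ∀ y, Line y → AlgPoints (S.M.obj Kc) (AlgebraicClosure (w.adicCompletion F))
  /-- D4: the READING of the `t₂`-translate (ideal translation `⟨ϖ⟩`, central at `w`). -/
  translΩ : AlgPoints (S.M.obj Kc) (AlgebraicClosure (w.adicCompletion F)) → AlgPoints (S.M.obj Kc) (AlgebraicClosure (w.adicCompletion F))
  /-- D8: the special quotient of `x̄` by a member of `Sub x̄`. -/
  quot : ∀ xbar, Sub xbar → AlgPoints (𝓜.localise w).reductionAt (geomResidueField w)
  /-- D8: the special ideal translation `⟨ϖ⟩`. -/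
  transl : AlgPoints (𝓜.localise w).reductionAt (geomResidueField w) → AlgPoints (𝓜.localise w).reductionAt (geomResidueField w)
  /-- D5: specialisation of a line (schematic closure over `𝒪_Ω̄`, then special fibre), read at `red₀ y`. -/
  sp : ∀ y, Line y → Sub (red₀Of S Kc 𝓜 w h𝓨 e y)
  /-- D7 = (c1) HECKE: the DICT՚s `hecke` field type TOKEN FOR TOKEN (translates `T_{rc₁ β} x′` = `quotΩ` of `u x′` by the lines through a bijection
  `e : Kc t₁ Kc ⁄ Kc ≃ Line (u x′)`; `T_{rc₂ β₂} x′ = translΩ (u x′)`). -/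
  hecke : ∀ (N' : C5.SmallLevel K₀) (hN'Kc : N' ≤ Kc)
    (rc₁ : orbit (Kc.1.1 : Subgroup ↥(finAdelic ↥(maximalRealSubfield F) F (IsCMField.complexConj F) 2 Jstar))
         ((UnitaryGroup.heckeElementAt ↥(maximalRealSubfield F) F (IsCMField.complexConj F) 2 Jstar
             (⟨w, rfl⟩ : UnitaryGroup.PlacesOver F (w.under (𝓞 ↥(maximalRealSubfield F))))
             (IsCMField.complexConj_ne_one F) hJ hw (UnitaryGroup.isUnit_placeForm Jstar hJu w) (HeckeCharacter.uniformizer F w) 1 :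
           ↥(finAdelic ↥(maximalRealSubfield F) F (IsCMField.complexConj F) 2 Jstar)) :
           ↥(finAdelic ↥(maximalRealSubfield F) F (IsCMField.complexConj F) 2 Jstar) ⧸
             (Kc.1.1 : Subgroup ↥(finAdelic ↥(maximalRealSubfield F) F (IsCMField.complexConj F) 2 Jstar))) →
       ↥(finAdelic ↥(maximalRealSubfield F) F (IsCMField.complexConj F) 2 Jstar)),
    (∀ β, ((rc₁ β : ↥(finAdelic ↥(maximalRealSubfield F) F (IsCMField.complexConj F) 2 Jstar)) :
        ↥(finAdelic ↥(maximalRealSubfield F) F (IsCMField.complexConj F) 2 Jstar) ⧸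
          (Kc.1.1 : Subgroup ↥(finAdelic ↥(maximalRealSubfield F) F (IsCMField.complexConj F) 2 Jstar))) = β.1) →
    ∀ (hrcN₁ : ∀ β, C5.HeckeLE (rc₁ β) N' Kc)
      (rc₂ : orbit (Kc.1.1 : Subgroup ↥(finAdelic ↥(maximalRealSubfield F) F (IsCMField.complexConj F) 2 Jstar))
         ((UnitaryGroup.heckeElementAt ↥(maximalRealSubfield F) F (IsCMField.complexConj F) 2 Jstar
             (⟨w, rfl⟩ : UnitaryGroup.PlacesOver F (w.under (𝓞 ↥(maximalRealSubfield F))))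
             (IsCMField.complexConj_ne_one F) hJ hw (UnitaryGroup.isUnit_placeForm Jstar hJu w) (HeckeCharacter.uniformizer F w) 2 :
           ↥(finAdelic ↥(maximalRealSubfield F) F (IsCMField.complexConj F) 2 Jstar)) :
           ↥(finAdelic ↥(maximalRealSubfield F) F (IsCMField.complexConj F) 2 Jstar) ⧸
             (Kc.1.1 : Subgroup ↥(finAdelic ↥(maximalRealSubfield F) F (IsCMField.complexConj F) 2 Jstar))) →
       ↥(finAdelic ↥(maximalRealSubfield F) F (IsCMField.complexConj F) 2 Jstar)),
    (∀ β, ((rc₂ β : ↥(finAdelic ↥(maximalRealSubfield F) F (IsCMField.complexConj F) 2 Jstar)) :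
        ↥(finAdelic ↥(maximalRealSubfield F) F (IsCMField.complexConj F) 2 Jstar) ⧸
          (Kc.1.1 : Subgroup ↥(finAdelic ↥(maximalRealSubfield F) F (IsCMField.complexConj F) 2 Jstar))) = β.1) →
    ∀ (hrcN₂ : ∀ β, C5.HeckeLE (rc₂ β) N' Kc),
    ∀ x' : AlgPoints (S.M.obj N') (AlgebraicClosure (w.adicCompletion F)),
      ∃ e : (orbit (Kc.1.1 : Subgroup ↥(finAdelic ↥(maximalRealSubfield F) F (IsCMField.complexConj F) 2 Jstar))
         ((UnitaryGroup.heckeElementAt ↥(maximalRealSubfield F) F (IsCMField.complexConj F) 2 Jstar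
             (⟨w, rfl⟩ : UnitaryGroup.PlacesOver F (w.under (𝓞 ↥(maximalRealSubfield F))))
             (IsCMField.complexConj_ne_one F) hJ hw (UnitaryGroup.isUnit_placeForm Jstar hJu w) (HeckeCharacter.uniformizer F w) 1 :
           ↥(finAdelic ↥(maximalRealSubfield F) F (IsCMField.complexConj F) 2 Jstar)) :
           ↥(finAdelic ↥(maximalRealSubfield F) F (IsCMField.complexConj F) 2 Jstar) ⧸
             (Kc.1.1 : Subgroup ↥(finAdelic ↥(maximalRealSubfield F) F (IsCMField.complexConj F) 2 Jstar)))) ≃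
          Line (AlgPoints.map (S.M.map (homOfLE hN'Kc)) x'),
        (∀ β, AlgPoints.map (recordHeckeTranslateGS S hU7ₛ (rc₁ β) N' Kc (hrcN₁ β)) x' =
            quotΩ (AlgPoints.map (S.M.map (homOfLE hN'Kc)) x') (e β)) ∧
        ∀ β₂, AlgPoints.map (recordHeckeTranslateGS S hU7ₛ (rc₂ β₂) N' Kc (hrcN₂ β₂)) x' =
            translΩ (AlgPoints.map (S.M.map (homOfLE hN'Kc)) x')
  /-- D5 = (c2): `red₀` commutes with the moduli quotient (Néron mapping property over `𝒪_Ω̄` + closure finite flat). -/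
  red_quotΩ : ∀ y (L : Line y), red₀Of S Kc 𝓜 w h𝓨 e (quotΩ y L) = quot (red₀Of S Kc 𝓜 w h𝓨 e y) (sp y L)
  /-- D5 = (c2): `red₀` commutes with the ideal translation `⟨ϖ⟩`. -/
  red_translΩ : ∀ y, red₀Of S Kc 𝓜 w h𝓨 e (translΩ y) = transl (red₀Of S Kc 𝓜 w h𝓨 e y)
  /-- D9 TWIST: transport of special subgroups along `θ(γ, 1)_s`. -/
  smap : ∀ (γ : Fi ≃ₐ[F] Fi) (xbar : AlgPoints (𝓜.localise w).reductionAt (geomResidueField w)), Sub xbar → Sub (actOf S Kc 𝓜 w θ γ xbar)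
  /-- D9 TWIST: the transport fixes the Frobenius kernel. -/
  smap_kerF : ∀ γ xbar, smap γ xbar (kerF xbar) = kerF (actOf S Kc 𝓜 w θ γ xbar)
  /-- D9 TWIST: the special quotient is `θ`-equivariant. -/
  quot_smap : ∀ γ xbar (H : Sub xbar), quot (actOf S Kc 𝓜 w θ γ xbar) (smap γ xbar H) = actOf S Kc 𝓜 w θ γ (quot xbar H)
  /-- LAYER (ii-1) D1: the UNIVERSAL abelian scheme over the localised model `𝓨 = (𝓜.localise w).total` (in print: the universal `(A, ι, λ, η̄^p)` of the
  RSZ ∕ Kottwitz PEL moduli problem pulled back to `𝓨`; REP F-LINEAR COVARIANT, LEAD M-16 (1)). [cite: RapoportSmithlingZhang2020Diagonal, §4.1 p. 17] -/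
  univ : Literature.AlgebraicGeometry.AbelianSchemes.AbelianSchemeOver (𝓜.localise w).total.left
  /-- LAYER (ii-1) D1: the `𝒪_F`-action `ι` on the universal abelian scheme ([Kottwitz1992] §5 p. 390; [Liu2021] Def. C.10 (1)). [cite: Kottwitz1992, §5, p. 390] -/
  act : Literature.AlgebraicGeometry.AbelianSchemes.AbelianSchemeOver.RingAction (𝓞 F) univ
  /-- LAYER (ii-1) D1: the dual abelian scheme `Â` with its Poincaré bundle (★ `DualPair`; data). [cite: MumfordAV1970, §13, p. 123] -/
  dual : univ.DualPair
  /-- LAYER (ii-1) D1: the polarization `λ : A → Â` (in print `λ` is EXACT in the moduli problem, HEART-FROB §A (A-ii); `𝒪_F`-compatibility `λ ∘ ι(a) = ι(ā)^∨ ∘ λ`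
  is the Prop of layer (ii-6), [RapoportSmithlingZhang2020Diagonal] §4.1). [cite: RapoportSmithlingZhang2020Diagonal, §4.1 p. 17] -/
  pol : univ.Polarization dual
  /-- LAYER (ii-2) D-1 LEVEL (desk g1, option (c) «principal»): the relative dimension `g` of `A` (in print `g = n·[F⁺:ℚ] = 2[F⁺:ℚ]`). [cite: RapoportSmithlingZhang2020Diagonal, §4.1 p. 17] -/
  g : ℕ
  /-- LAYER (ii-2) D-1 LEVEL: the full level `N` (GEN takes `Kc^p` = the principal congruence subgroup `K_Λ(N)^p` of a `K`-stable lattice `Λ`, so that RSZ՚s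
  `η̄^p mod Kc^p` is a PAIR of full level-`N` trivialisations of `A₀[N]`, `A[N]` over `Fᵢ ⊇ F(A₀[N])`). [cite: RapoportSmithlingZhang2020Diagonal, §4.1 p. 17] [cite: Kottwitz1992, §5, p. 391] -/
  N : ℕ
  /-- LAYER (ii-2) D-1 LEVEL: the full level-`N` structure on `A` over the WHOLE localised model `𝓨` (★ MFK `LevelStructure`: `2g` sections trivialising `A[N]`
  on every geometric fibre; extends over `𝓨` since `p ∤ N`).  Its readings at generic ∕ special points are ★ `restrictPt` of ★ `LevelStructure.baseChange`,
  so the reduction ∕ Frobenius ∕ twist transport laws of the level are LEMMAS (pull-back functoriality), not fields. [cite: MumfordFogartyKirwan1994, Ch. 7 §2 Definition 7.1 (p. 129)] -/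
  lvl : univ.LevelStructure g N
  /-- LAYER (ii-2) **INJ — IMAGE-INJ WITHIN ONE SHEET** (LEAD M-17f (R1); A-p03 RISK «INJ ACROSS SHEETS», ref1 e-7, F0P5a-ref1 concur): for two record points
  `y₁, y₂ ∈ M⋆_{Kc}(Ω)` whose READINGS `red₀ y₁, red₀ y₂ ∈ 𝓨_s(κ̄(w))` on the sheet `e` carry ISOMORPHIC `A`-tuples `(A, ι, λ, lvl)` (★ MFK `IsBaseChangeVia`
  along `𝟙`, helper `tupleIsoAt`: EXACT `λ`, EXACT full level `N`; the auxiliary `A₀`-tuple is CONSTANT along the sheet — the sheet IS the slice `{a₀(e)} × M_K`,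
  [RapoportSmithlingZhang2020Diagonal] (3.10), p. 20 L4–5 — so NO `₀`-hypothesis: ref1 (g2) o-9, A-p13 «π₀ AND EXACT LEVEL»), the readings are EQUAL — fine-moduli injectivity on `κ̄`-points INSIDE ONE special sheet
  ([MumfordFogartyKirwan1994] Thm. 7.9 + remark p. 139, `N ≥ 3`; [RapoportSmithlingZhang2020Diagonal] Thm. 4.1; [Kottwitz1992] §5 p. 391).  NOT the global `∀ x̄₁ x̄₂ : P₀` form:
  `P₀ = 𝓨_s(κ̄)` is a disjoint union of special sheets over which the tuple data (pulled back from the moduli scheme over the reflex-type base) is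
  SHEET-BLIND, so the global form is false once `[Fᵢ : E′] > 1` (★ INT-RES `specialSheet`, `hdisj`); this image form is exactly the premise HEART-FROB′ uses (both
  sides are `red₀Of … e (_)`).  Why it might fail: false if `Kc^p` is not EXACTLY principal (`K_Λ(N)^p`; a proper normal core of `K ∩ K(N)` identifies distinct
  points) — GEN՚s `Kc` (organ PRINCIPAL LEVEL ≤ K); the card՚s J-row «INJ witness» quotes the sheet; GEN՚s identification `𝓨_η ≅ X ⊗ Fᵢ` must be SLICE-WISE (J-row «INJ slice»). [cite: MumfordFogartyKirwan1994, Ch. 7 §3 Theorem 7.9 and the remark following it (p. 139)] [cite: RapoportSmithlingZhang2020Diagonal, §4.1 p. 17] [cite: Kottwitz1992, §5, p. 391] -/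
  inj₀ : ∀ y₁ y₂ : AlgPoints (S.M.obj Kc) (AlgebraicClosure (w.adicCompletion F)),
    tupleIsoAt (spPt 𝓜 w (red₀Of S Kc 𝓜 w h𝓨 e y₁)) (spPt 𝓜 w (red₀Of S Kc 𝓜 w h𝓨 e y₂)) univ act dual pol lvl →
    red₀Of S Kc 𝓜 w h𝓨 e y₁ = red₀Of S Kc 𝓜 w h𝓨 e y₂
  /-- LAYER (ii-6) **TWIST IDEAL** (data): the integral ideal `𝔞_γ ⊆ 𝒪_F` by which the model automorphism `θ(γ, 1)` Serre-twists the universal PEL tuple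
  (`θ(γ,1)^*(A₀, A, …) ≅ (A₀, A, …) ⊗_{𝒪_F} 𝔞_γ`: `γ` moves the auxiliary CM point `a₀ ∈ M₀(Fᵢ)` to its conjugate `a₀^γ = a₀ ⊗ 𝔞_γ` by the main theorem
  of complex multiplication, and the slice `{a₀(e)} × M_K` of RSZ՚s `M₀ × M_K` (frame chosen per `w`, o-8) to the slice of the sheet `e∘γ`; the tuple-level law is the Serre cover
  `𝒯(ℓ_e y) ≅ 𝒯(ℓ_{e∘γ} y) ⊗ 𝔞_γ`, helper `CoverΩ`, GEN-side).  DATA chosen by GEN (prime to `N` in print); READ BY `frob₀` (`frobIdeal_spec : 𝔠(γ)𝔭_w = 𝔞_γ`, `frob₀_cover` presents `𝔞_γ`). [cite: RapoportSmithlingZhang2020Diagonal, §3.4–§3.5, pp. 12–14] [cite: Shimura1998, §18.6, Main Theorem 1] -/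
  twistIdeal : (Fi ≃ₐ[F] Fi) → Ideal (𝓞 F)
  /-- LAYER (ii-6′) **TWIST IDEALS PRIME TO THE LEVEL** [Defs ED. 2, (f6)]: `𝔞_γ + (N) = 𝒪_F` for every `γ` (GEN: the ray-class representative `𝔞_γ` is CHOSEN prime to `N` — free, [Shimura1998] §7.5
  Prop. 24).  READ BY HFROB (J10 LEVEL clause): every road matches the EXACT level-`N` structures of `A_{x̄′}` and `A_x̄″` through an `𝔞_γ`-isogeny, which identifies the level points only
  modulo `A[𝔞_γ] ∩ A[N]` — trivial iff this clause (A-p13 (g36) 21:19:40Z: BRICK V `level_transport_of_roof_of_cover`, hypothesis `hcop`, token-identical; lit1 (g3) print word 21:20:24Z).  The v0.4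
  field text VERBATIM (dropped at v0.5 under M-17r when no letter body read it yet; restored now that the HFROB road names its reader). [cite: Shimura1998, §7.5 Prop. 24 (pp. 57–58); §18.6 p. 127] -/
  twistIdeal_coprime : ∀ γ : Fi ≃ₐ[F] Fi, twistIdeal γ ⊔ Ideal.span {((N : ℕ) : 𝓞 F)} = ⊤
  /-- LAYER (ii-6″) **TWIST IDEALS ARE NONZERO** [Defs ED. 3, LEAD «M-24 TONIGHT» (α) 2026-09-01T22:55:50Z]: `𝔞_γ ≠ 0` for every `γ` — the integral ideal by
  which the model automorphism `θ(γ, 1)` Serre-twists the universal PEL tuple is the ideal of an idele (a lattice index), never zero.  NOT derivable from the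
  ED. 2 fields (A-p03 (g30) finding, desk census 22:55:19Z): `twistIdeal_coprime` with `𝔞_γ = ⊥` only forces `(N) = ⊤`, and `FrobCover₀` (clauses (f1)(f1′)(f3)) then
  admits the `g = 0` datum.  Consumed VERBATIM as the hypothesis `hne` of BRICK Σ2 `heartFrob_of_twistIdeal_ne_bot` (`Lines/F0_P6a_StubHFROBSigma2.lean`, A-p13 (g36),
  LEAD «M-32») so that main ED. 6 closes `stub_HFROB 𝔇 := heartFrob_of_twistIdeal_ne_bot 𝔇 𝔇.twistIdeal_ne_bot …` by import.  GEN pays in one line.  Why it might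
  fail: it cannot for GEN՚s witness (an idele ideal); a consumer wanting `𝔞_γ` PROPER (`≠ ⊤`) must NOT read it here (`γ = 1` has `𝔞_1 = 𝒪_F`).
  [cite: Shimura1998, §13.1, Theorem 1 (pp. 97–99); §18.6 proof of Thm. 18.6, p. 127] -/
  twistIdeal_ne_bot : ∀ γ : Fi ≃ₐ[F] Fi, twistIdeal γ ≠ ⊥
  /-- LAYER (ii-4) the rational prime `p` under `w` — the scalar of the isogeny roofs (`λ_B` = descent of `p·λ`). [cite: Kottwitz1992, §5, p. 390] -/
  pChar : ℕ
  /-- LAYER (ii-4) `p` is prime and lies in `𝔭_w` (so `p = char κ(w)`, `q := #κ(w) = p^{f_w}`, `d_w := [F_w : ℚ_p] = e_w f_w`; `hpChar.1` is READ by the `ExpChar` openers of `block₀`∕`frob₀`, `hpChar.2` makes `charP₀` satisfiable). [cite: Kottwitz1992, §5, p. 390] -/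
  hpChar : Nat.Prime pChar ∧ (pChar : 𝓞 F) ∈ w.asIdeal
  /-- LAYER (ii-5′) **TWIST NORM** (data): `n_γ : ℕ`, the `λ`-scalar of the Serre cover reading the sheet change `γ` (`c^*λ = n_γ·λ`; in print `(n_γ) = 𝔞_γ𝔞̄_γ`, the relative type norm); READ BY `frob₀`
  ((f3) of `frob₀_cover`, and `twistNorm_eq : n_γ = p^f` at a `γ` reading a Frobenius).  v0.5 (LEAD M-17r TOKEN = DROP): replaces the generic twist package as a FIELD — the generic Serre covers
  (helper `CoverΩ` ∕ `TwistReadingΩ`, kept below as GEN՚s vocabulary) are GEN՚s MEANS to prove `frob₀.frob₀_cover`, not an input any letter reads. [cite: Shimura1998, §13.1, Theorem 1; §18.6] -/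
  twistNorm : (Fi ≃ₐ[F] Fi) → ℕ
  -- ===================== v0.5 (desk g1): (R-1) THE `heart_of_carriers` SOCKET BLOCK and (R-2) THE DOWNSTAIRS FROBENIUS READINGS — LEAD M-17j (2), ref1 (g2) J10 =====================
  /-- (R-1) ZERO-ORGAN UNBLOCK (LEAD M-17j (3)(c)): the residue degree `f = f_w` with `q := N(w) = p^f`. [cite: Kottwitz1992, §5, p. 390] -/
  fDeg : ℕ
  /-- (R-1) ZERO-ORGAN UNBLOCK (LEAD M-17j (3)(c); ref1: box-clean, Prop-irrelevant at ED. 4): `κ̄(w)` has characteristic `p` — a Prop FIELD supplied by GEN from `hpChar.2`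
  (★ organ `charP_geomResidueField` (A-p14) when it lands); the two readings below open with `haveI := charP₀; haveI := ExpChar.prime hpChar.1`. [cite: SerreTate1968, §1] -/
  charP₀ : CharP (geomResidueField w) pChar
  /-- (R-1) **THE `heart_of_carriers` SOCKET BLOCK** on the universal tuple `(univ, act)` and the carriers `Line Sub kerF IsEtale quot transl sp` (structure `BlockReading₀`: `G₀ β₀` pinned to
  `A_x̄[𝔭_{c•w}]`, unit components, numerics, `subEquiv ∕ kerF_spec ∕ isEtale_spec`, layer maps, D6 kills-form, canonical line).  HEART ← these fields + ★∕P6c `heart_of_carriers` (+ `hFr hcover`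
  from ★ FROB-SHEET, `hHFimg` from HFROB); RGD supplies them (K∕BT chain + P6b). [cite: Tate1997FiniteFlatGroupSchemes, (3.7)] [cite: Liu2021, Prop. D.8 p. 135, p. 137] -/
  block₀ : haveI : CharP (geomResidueField w) pChar := charP₀; haveI : ExpChar (geomResidueField w) pChar := ExpChar.prime hpChar.1;
    BlockReading₀ S Kc 𝓜 w h𝓨 e univ act pChar fDeg Line Sub kerF IsEtale quot transl sp
  /-- (R-2) **THE DOWNSTAIRS FROBENIUS READINGS** on the universal tuple (structure `FrobReading₀`: `frobIdeal` with `𝔠𝔭_w = 𝔞_γ`, `quot₀_roof : Roof₀ …` with the Frobenius-kernel law (rL) =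
  ★ σ2-CORE `hker`, `frob₀_cover : FrobCover₀ …`).  HFROB ← these fields + ★ σ2-CORE∕σ2-CORE-λ∕`RelFrobeniusPolarizedRecognition`∕`SerreTranslateComposition` + `inj₀` (card J10 row); RGD supplies
  them (reduction of the generic roof ∕ Serre cover — helpers `RoofΩ` ∕ `CoverΩ` — along integral points: organs (S-c), (d5)(d6), Serre BC ★ p846354; the congruence relation [Liu2021] D.8 (3) pp. 136–138, [Wedhorn2000], Kottwitz §5).
  [cite: Liu2021, Prop. D.8 (3) p. 135, pp. 136–138] [cite: Shimura1998, §13.1 Thm. 1 (pp. 97–99)] -/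
  frob₀ : haveI : ExpChar (geomResidueField w) pChar := (haveI : CharP (geomResidueField w) pChar := charP₀; ExpChar.prime hpChar.1);
    FrobReading₀ S Kc 𝓜 w h𝓨 e univ act dual pol lvl pChar fDeg Line Sub kerF quotΩ sp twistIdeal twistNorm


/-! ### §2′ LAYER (ii-1) DERIVED: the fibre tuples of the datum (abbreviations of the §1′ helpers at `𝔇.univ`) -/
/-- DERIVED (ii-1): the generic fibre abelian variety `A_y ∕ Ω` of the datum at a record point `y`. [cite: SerreTate1968, §1, Lemma 2] -/
noncomputable abbrev ModuliDatum.tupleΩ {F : Type} [Field F] [NumberField F] [IsCMField F] {ι₁ : F →+* ℂ} {Jstar : Matrix (Fin 2) (Fin 2) F}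
    {K₀ : C5.OpenCompactSubgroup ↥(finAdelic ↥(maximalRealSubfield F) F (IsCMField.complexConj F) 2 Jstar)}
    {S : RecordSystemGS F Jstar ι₁ K₀} {hU7ₛ : S.HeckeTranslateDefinedOver}
    {hJ : (Jstar.map (IsCMField.complexConj F))ᵀ = Jstar} {hJu : IsUnit Jstar}
    {Fi : Type} [Field Fi] [Algebra F Fi] {Kc : C5.SmallLevel K₀} {G : Type} [Group G]
    {𝓜 : IntegralModel (𝓞 F) F ((thickening F Fi).obj (S.M.obj Kc))}
    {w : HeightOneSpectrum (𝓞 F)} {hw : (IsCMField.complexConj F) • w ≠ w} {h𝓨 : (𝓜.localise w).IsSmoothProper 1}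
    {θ : ActionOver (𝓜.localise w).total.hom ((Fi ≃ₐ[F] Fi) × G)}
    {e : Fi →ₐ[F] AlgebraicClosure (w.adicCompletion F)}
    (𝔇 : ModuliDatum F ι₁ Jstar K₀ S hU7ₛ hJ hJu Fi Kc G 𝓜 w hw h𝓨 θ e)
    (y : AlgPoints (S.M.obj Kc) (AlgebraicClosure (w.adicCompletion F))) :
    Literature.AlgebraicGeometry.Motives.AbelianVariety (AlgebraicClosure (w.adicCompletion F)) :=
  fibreΩOf S Kc 𝓜 w e 𝔇.univ y

/-- DERIVED (ii-1): the special fibre abelian variety `A_x̄ ∕ κ̄(w)` of the datum at a special point `x̄`. [cite: SerreTate1968, §1, Lemma 2] -/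
noncomputable abbrev ModuliDatum.tuple₀ {F : Type} [Field F] [NumberField F] [IsCMField F] {ι₁ : F →+* ℂ} {Jstar : Matrix (Fin 2) (Fin 2) F}
    {K₀ : C5.OpenCompactSubgroup ↥(finAdelic ↥(maximalRealSubfield F) F (IsCMField.complexConj F) 2 Jstar)}
    {S : RecordSystemGS F Jstar ι₁ K₀} {hU7ₛ : S.HeckeTranslateDefinedOver}
    {hJ : (Jstar.map (IsCMField.complexConj F))ᵀ = Jstar} {hJu : IsUnit Jstar}
    {Fi : Type} [Field Fi] [Algebra F Fi] {Kc : C5.SmallLevel K₀} {G : Type} [Group G]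
    {𝓜 : IntegralModel (𝓞 F) F ((thickening F Fi).obj (S.M.obj Kc))}
    {w : HeightOneSpectrum (𝓞 F)} {hw : (IsCMField.complexConj F) • w ≠ w} {h𝓨 : (𝓜.localise w).IsSmoothProper 1}
    {θ : ActionOver (𝓜.localise w).total.hom ((Fi ≃ₐ[F] Fi) × G)}
    {e : Fi →ₐ[F] AlgebraicClosure (w.adicCompletion F)}
    (𝔇 : ModuliDatum F ι₁ Jstar K₀ S hU7ₛ hJ hJu Fi Kc G 𝓜 w hw h𝓨 θ e)
    (xbar : AlgPoints (𝓜.localise w).reductionAt (geomResidueField w)) :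
    Literature.AlgebraicGeometry.Motives.AbelianVariety (geomResidueField w) :=
  fibre₀Of 𝓜 w 𝔇.univ xbar

/-! ### §3 The heart clause HEART-FROB′ (FORM-II, tuple-free, one clause for ordinary and supersingular points) -/

/-- **HEART-FROB′ — `𝔇.HeartFrob`**: for every arithmetic Frobenius `σ ∈ Γ_{F_w}`, every generic point `y` and every line `L` of `y` specialising to
the Frobenius kernel, the reading of the `t₁`-translate picked by `L` reduces to the reduction of `σ • y` (Galois action on `Ω`-points, ★
`AlgPoints` `MulAction`).  In print: the quotient of `(A, ι, λ, η̄)` by the canonical subgroup (⊕ its dual position) reduces to the relative-Frobenius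
twist `(A^{(q)}, …)` on the same sheet — [Liu2021] pp. 137–138 via [SP 0CCZ], [Carayol1986Compositio] §10.3; at a supersingular point every line
specialises to `ker F` and every `t₁`-translate reduces to the Frobenius twist.  Orientation SETTLED (K-TEST «t₁» ★ p845445, LEAD M-16 (2)): the block is
`𝒢_y = A_y[(c•w)^∞]`, `A₀` multiplicative at `w`, `k = 0` — it lives in the PROOF (layer (ii)), not in this statement.  WHY IT MIGHT FAIL (as typed): (i) `σ • y` changes the sheet — absorbed: both sides are read on the
sheet `e` and ★ p845200 (ii) identifies the right side with `Fr₀ (red₀ y)`; (ii) at `w` ramified in `Fᵢ`: MOOT — `h𝓨` is uninhabited there (a smooth proper `𝓞_{F,(w)}`-model of the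
thickening cannot exist: its fibre over `w_i^{e_i}`, `e_i ≥ 2`, would be non-reduced; F0P5a-ref1 (s3)(a)); (iii) at a split `w ∣ level(Kc)` with good reduction the
letters below carry MH՚s guards `hunit`∕`hKc`∕`hdisj` explicitly (F0P5a-ref1 (s3)(b)), so nothing is claimed where MH consumes nothing.
[cite: Liu2021, Prop. D.8 (3) p. 135, pp. 137–138] [cite: Carayol1986Compositio, §10.3 Prop. p. 211] [cite: SerreTate1968, §1 Lemma 2] -/
def ModuliDatum.HeartFrob {F : Type} [Field F] [NumberField F] [IsCMField F] {ι₁ : F →+* ℂ} {Jstar : Matrix (Fin 2) (Fin 2) F}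
    {K₀ : C5.OpenCompactSubgroup ↥(finAdelic ↥(maximalRealSubfield F) F (IsCMField.complexConj F) 2 Jstar)}
    {S : RecordSystemGS F Jstar ι₁ K₀} {hU7ₛ : S.HeckeTranslateDefinedOver}
    {hJ : (Jstar.map (IsCMField.complexConj F))ᵀ = Jstar} {hJu : IsUnit Jstar}
    {Fi : Type} [Field Fi] [Algebra F Fi] {Kc : C5.SmallLevel K₀} {G : Type} [Group G]
    {𝓜 : IntegralModel (𝓞 F) F ((thickening F Fi).obj (S.M.obj Kc))}
    {w : HeightOneSpectrum (𝓞 F)} {hw : (IsCMField.complexConj F) • w ≠ w} {h𝓨 : (𝓜.localise w).IsSmoothProper 1}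
    {θ : ActionOver (𝓜.localise w).total.hom ((Fi ≃ₐ[F] Fi) × G)} {e : Fi →ₐ[F] AlgebraicClosure (w.adicCompletion F)}
    (𝔇 : ModuliDatum F ι₁ Jstar K₀ S hU7ₛ hJ hJu Fi Kc G 𝓜 w hw h𝓨 θ e) : Prop :=
  ∀ (σ : Field.absoluteGaloisGroup (w.adicCompletion F)), IsAbsArithFrob σ →
    ∀ (y : AlgPoints (S.M.obj Kc) (AlgebraicClosure (w.adicCompletion F))) (L : 𝔇.Line y),
      𝔇.sp y L = 𝔇.kerF (red₀Of S Kc 𝓜 w h𝓨 e y) →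
        red₀Of S Kc 𝓜 w h𝓨 e (𝔇.quotΩ y L) = red₀Of S Kc 𝓜 w h𝓨 e (σ • y)

/-! ### §4 The three ED. 3 letters -/

/-- **LETTER RGD — `RecordModuliDatumCofinal`** (XL; REP + GEN + HECKE + TWIST, and at layer (ii) INJ + FROB₀ + BANAL).  MH՚s telescope TOKEN FOR TOKEN
(record datum, small level `K` ↦ `Fᵢ` Galois, `Kc ≤ K` normalised, `G`, `φ`, the global model `𝓜` with its five properties, the bad set `S_M`; at every
split `w ∉ S_M` with unit place form and `K` hyperspecial: `Kc` hyperspecial, and for every `h𝓨`, `θ` with MH՚s `Γ`-part, and sheet `e`:) DISJOINT SPECIAL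
SHEETS (`hdisj`, ★ p845200՚s hypothesis verbatim; a theorem cofinitely for the witness `𝓜 := restrictScalarsOfIntermediate hinj 𝓜ᵢ`, ★ p845310) AND a
moduli datum.  In print: the RSZ ∕ Kottwitz fine moduli scheme over `𝒪_F[1∕N]` (the reflex ring; reflex field `= F` under `[IsGalois ℚ F]`), base-changed to `𝒪_{Fᵢ}[1∕N]` for the thickening ∕ full-level-`N` trivialisation (lit1 P6L-059 (w3); REP: [Kottwitz1992] §5, [HarrisTaylorAMS2001] p. 110 l. 1–3), its generic
fibre `= M⋆_{Kc} ⊗_F Fᵢ` (GEN: [Liu2021] Rem. C.2, Lemma C.18, proof of Prop. C.20; [RapoportSmithlingZhang2020Diagonal] Thm. 4.1), Hecke = isogeny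
([HarrisTaylorAMS2001] §III.4).  WITNESS (RGD DOOR = SPREAD, LEAD M-17k∕M-17l; REP-Z banked): `𝓜 :=` the SPREAD of the char-0 PEL tuple of `M⋆_{Kc} ⊗ Fᵢ` over
`𝒪_{Fᵢ}[1∕M]` (cofinitely smooth ∕ proper; ★ `AbelianSchemeSpread` lineage) — NO integral moduli interpretation of the special fibres is claimed by this Prop: every special-fibre
field of the datum is discharged COFINITELY by constructibility (`inj₀`: `Isom` of finite type, empty off the diagonal generically ⇒ over an open), CM theory
(`frob₀`, `twistIdeal ∕ twistNorm`), lifting ∕ block structure (`quot`, `sp`, `block₀`); the printed integral fine moduli scheme is cited as the source of the statements,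
not rebuilt.  WHY IT MIGHT FAIL (as typed): (i) fine representability needs `N ≥ 3`, `w ∤ N` — absorbed by `Kc`, `S_M`; (ii) ONE `Fᵢ` for
all components ([Liu2021] Rem. C.2); (iii) `hdisj` fails at primes ramified in `Fᵢ` — absorbed by `S_M`.  NOT asserted.
(print: Kottwitz1992, §5 pp. 389–391, §8 p. 400) (print: RapoportSmithlingZhang2020Diagonal, §4.1 Thm. 4.1 p. 17) (print: Liu2021, Rem. C.2 p. 108, Lemma C.18 p. 115, proof of Prop. C.20 p. 118)
(print: HarrisTaylorAMS2001, §III.4, pp. 108–110; p. 110 l. 1–3) (print: SGA1, Exp. V §1) -/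
def RecordModuliDatumCofinal : Prop :=
  ∀ (F : Type) [Field F] [NumberField F] [IsCMField F] [IsGalois ℚ F] (ι₁ : F →+* ℂ)
    (Jstar : Matrix (Fin 2) (Fin 2) F)
    (K₀ : C5.OpenCompactSubgroup ↥(finAdelic ↥(maximalRealSubfield F) F (IsCMField.complexConj F) 2 Jstar))
    (S : RecordSystemGS F Jstar ι₁ K₀) (hU7ₛ : S.HeckeTranslateDefinedOver)
    (hJ : (Jstar.map (IsCMField.complexConj F))ᵀ = Jstar) (hJu : IsUnit Jstar) (K : C5.SmallLevel K₀),
    ∃ (Fi : Type) (_ : Field Fi) (_ : Algebra F Fi) (_ : FiniteDimensional F Fi) (_ : IsGalois F Fi)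
      (Kc : C5.SmallLevel K₀) (_hKcK : Kc ≤ K) (_hn : ∀ k ∈ K.1.1, C5.HeckeLE k Kc Kc)
      (G : Type) (_ : Group G) (_ : Finite G) (φ : ↥K.1.1 →* G) (_hφ : Function.Surjective φ)
      (_hφker : φ.ker = (Kc.1.1 : Subgroup ↥(finAdelic ↥(maximalRealSubfield F) F (IsCMField.complexConj F) 2 Jstar)).subgroupOf K.1.1)
      (𝓜 : IntegralModel (𝓞 F) F ((thickening F Fi).obj (S.M.obj Kc)))
      (_ : QuasiCompact 𝓜.total.hom) (_ : QuasiSeparated 𝓜.total.hom) (_ : LocallyOfFinitePresentation 𝓜.total.hom)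
      (_ : Flat 𝓜.total.hom) (_ : IsSeparated 𝓜.total.hom)
      (S_M : Set (HeightOneSpectrum (𝓞 F))), S_M.Finite ∧
      ∀ w : HeightOneSpectrum (𝓞 F), w ∉ S_M → ∀ hw : (IsCMField.complexConj F) • w ≠ w,
        (UnitaryGroup.isUnit_placeForm Jstar hJu w).unit ∈ glInt 2 (w.adicCompletion F) →
          UnitaryGroup.IsHyperspecialAt ↥(maximalRealSubfield F) F (IsCMField.complexConj F) 2 Jstar K.1.1
            (w.under (𝓞 ↥(maximalRealSubfield F))) →
          UnitaryGroup.IsHyperspecialAt ↥(maximalRealSubfield F) F (IsCMField.complexConj F) 2 Jstar Kc.1.1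
              (w.under (𝓞 ↥(maximalRealSubfield F))) ∧
          ∀ (h𝓨 : (𝓜.localise w).IsSmoothProper 1)
            (θ : ActionOver (𝓜.localise w).total.hom ((Fi ≃ₐ[F] Fi) × G))
            (_hθ : ∀ γ : Fi ≃ₐ[F] Fi,
               (genericFibre (HeightOneSpectrum.valuationSubringAtPrime F w) F).map
                     (Over.isoMk (θ.aut (γ, 1)) (θ.aut_comp (γ, 1))).hom ≫ (𝓜.localise w).genericIso'.hom
                 = (𝓜.localise w).genericIso'.hom ≫
                     (Over.isoMk ((thickeningGalAction (L := Fi) (S.M.obj Kc)).aut γ)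
                       ((thickeningGalAction (L := Fi) (S.M.obj Kc)).aut_comp γ)).hom)
            (e : Fi →ₐ[F] AlgebraicClosure (w.adicCompletion F)),
            haveI : AlgebraicGeometry.IsProper (𝓜.localise w).total.hom := h𝓨.2
            (∀ (β : Fi ≃ₐ[F] Fi) (P Q : AlgPoints (S.M.obj Kc) (AlgebraicClosure (w.adicCompletion F))),
                (𝓜.localise w).geomReductionMap (thickeningLift e (S.M.obj Kc) P) =
                  AlgPoints.map ((specialFibreFunctor w).map (Over.isoMk (θ.aut (β, 1)) (θ.aut_comp (β, 1))).hom :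
                      (𝓜.localise w).reductionAt ⟶ (𝓜.localise w).reductionAt)
                    ((𝓜.localise w).geomReductionMap (thickeningLift e (S.M.obj Kc) Q)) → β = 1) ∧
              Nonempty (ModuliDatum F ι₁ Jstar K₀ S hU7ₛ hJ hJu Fi Kc G 𝓜 w hw h𝓨 θ e)

/-- **LETTER HFROB — `RecordHeartFrobenius`** (rank 2; the CONTENT of [Liu2021] Prop. D.8 (3) one Galois layer up, tuple-free): every moduli datum at
MH՚s binders satisfies HEART-FROB′.  In print: the canonical subgroup of the ordinary `𝒢_y` lifts `ker F`; the quotient by it (⊕ dual position) IS the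
Frobenius twist — on CM points by Shimura–Taniyama, on all points by Serre–Tate ∕ INJ ([Liu2021] pp. 137–138, [SP 0CCZ]); named sub-lemma CENTRAL-OR
(HEART-FROB.md §E).  WHY IT MIGHT FAIL (as typed): over LAYER (i) ALONE it is FALSE for a perverse datum (D418) — it is stated for the datum WITH layer
(ii) (appended before the box); the reading (K-TEST «t₁» ★ p845445, M-16 (2): `quotΩ` as READ = index-`q` sublattice at `w` = quotient by a line of the
`c•w`-side block `𝒢_y`, `A₀` multiplicative at `w`, REP F-linear covariant) shapes the proof, not this statement.  NOT asserted.
(print: Liu2021, Prop. D.8 (3) p. 135, pp. 137–138) (print: Carayol1986Compositio, §10.3 Prop. p. 211) (print: Wedhorn2000CongruenceRelation, main theorem (Introduction)) -/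
def RecordHeartFrobenius : Prop :=
  ∀ (F : Type) [Field F] [NumberField F] [IsCMField F] [IsGalois ℚ F] (ι₁ : F →+* ℂ)
    (Jstar : Matrix (Fin 2) (Fin 2) F)
    (K₀ : C5.OpenCompactSubgroup ↥(finAdelic ↥(maximalRealSubfield F) F (IsCMField.complexConj F) 2 Jstar))
    (S : RecordSystemGS F Jstar ι₁ K₀) (hU7ₛ : S.HeckeTranslateDefinedOver)
    (hJ : (Jstar.map (IsCMField.complexConj F))ᵀ = Jstar) (hJu : IsUnit Jstar)
    (Fi : Type) [Field Fi] [Algebra F Fi] [FiniteDimensional F Fi] [IsGalois F Fi]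
    (Kc : C5.SmallLevel K₀) (G : Type) [Group G] [Finite G]
    (𝓜 : IntegralModel (𝓞 F) F ((thickening F Fi).obj (S.M.obj Kc)))
    (w : HeightOneSpectrum (𝓞 F)) (hw : (IsCMField.complexConj F) • w ≠ w) (h𝓨 : (𝓜.localise w).IsSmoothProper 1)
    (θ : ActionOver (𝓜.localise w).total.hom ((Fi ≃ₐ[F] Fi) × G))
    (_hθ : ∀ γ : Fi ≃ₐ[F] Fi,
       (genericFibre (HeightOneSpectrum.valuationSubringAtPrime F w) F).map
             (Over.isoMk (θ.aut (γ, 1)) (θ.aut_comp (γ, 1))).hom ≫ (𝓜.localise w).genericIso'.hom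
         = (𝓜.localise w).genericIso'.hom ≫
             (Over.isoMk ((thickeningGalAction (L := Fi) (S.M.obj Kc)).aut γ)
               ((thickeningGalAction (L := Fi) (S.M.obj Kc)).aut_comp γ)).hom)
    (e : Fi →ₐ[F] AlgebraicClosure (w.adicCompletion F))
    (_hunit : (UnitaryGroup.isUnit_placeForm Jstar hJu w).unit ∈ glInt 2 (w.adicCompletion F))
    (_hKc : UnitaryGroup.IsHyperspecialAt ↥(maximalRealSubfield F) F (IsCMField.complexConj F) 2 Jstar Kc.1.1
      (w.under (𝓞 ↥(maximalRealSubfield F))))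
    (_hdisj : haveI : AlgebraicGeometry.IsProper (𝓜.localise w).total.hom := h𝓨.2
      ∀ (β : Fi ≃ₐ[F] Fi) (P Q : AlgPoints (S.M.obj Kc) (AlgebraicClosure (w.adicCompletion F))),
        (𝓜.localise w).geomReductionMap (thickeningLift e (S.M.obj Kc) P) =
          AlgPoints.map ((specialFibreFunctor w).map (Over.isoMk (θ.aut (β, 1)) (θ.aut_comp (β, 1))).hom :
              (𝓜.localise w).reductionAt ⟶ (𝓜.localise w).reductionAt)
            ((𝓜.localise w).geomReductionMap (thickeningLift e (S.M.obj Kc) Q)) → β = 1)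
    (𝔇 : ModuliDatum F ι₁ Jstar K₀ S hU7ₛ hJ hJu Fi Kc G 𝓜 w hw h𝓨 θ e),
      𝔇.HeartFrob

/-- **LETTER HEART — `RecordHeartDictionary`** (L; formal at ED. 4 from P6c՚s `heart_of_constructors`): at MH՚s binders, for every moduli datum `𝔇`, every
arithmetic Frobenius `σ` and every `Fr₀` READING `σ` on all sheets (★ p845200 (ii)) and `θ`-equivariant (★ p845200 (iii)), HEART-FROB′ yields the
ISOGENY DICTIONARY `PointDictionary … Kc P₀ Fr₀ red₀` (DICT 81cfdcf7): fields (c1)(c2) are `𝔇`՚s, (c3a) from `HeartFrob` + (c2) + (ii) on the image and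
TRANSPORT (★ p845239) + SHEET-COVER (★ p845161) off it, (c3b)(c3c)(b)(b4′) from the P6b ∕ P6d organs through `𝔇`՚s layers (P6c CONSTRUCTOR-SKELETON v0 §3).
WHY IT MIGHT FAIL (as typed): the binder `Fr₀` is ANY map with (ii)(iii) — fine: (ii) at the sheet `e` pins `Fr₀` on the image of `red₀` and (iii) +
SHEET-COVER pin it everywhere.  NOT asserted.
(print: Liu2021, Prop. D.8 p. 135, pp. 136–138) (print: HarrisTaylorAMS2001, §III.4, pp. 108–110) (print: Carayol1986Compositio, §10.3 Prop. p. 211) -/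
def RecordHeartDictionary : Prop :=
  ∀ (F : Type) [Field F] [NumberField F] [IsCMField F] [IsGalois ℚ F] (ι₁ : F →+* ℂ)
    (Jstar : Matrix (Fin 2) (Fin 2) F)
    (K₀ : C5.OpenCompactSubgroup ↥(finAdelic ↥(maximalRealSubfield F) F (IsCMField.complexConj F) 2 Jstar))
    (S : RecordSystemGS F Jstar ι₁ K₀) (hU7ₛ : S.HeckeTranslateDefinedOver)
    (hJ : (Jstar.map (IsCMField.complexConj F))ᵀ = Jstar) (hJu : IsUnit Jstar)
    (Fi : Type) [Field Fi] [Algebra F Fi] [FiniteDimensional F Fi] [IsGalois F Fi]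
    (Kc : C5.SmallLevel K₀) (G : Type) [Group G] [Finite G]
    (𝓜 : IntegralModel (𝓞 F) F ((thickening F Fi).obj (S.M.obj Kc)))
    (w : HeightOneSpectrum (𝓞 F)) (hw : (IsCMField.complexConj F) • w ≠ w) (h𝓨 : (𝓜.localise w).IsSmoothProper 1)
    (θ : ActionOver (𝓜.localise w).total.hom ((Fi ≃ₐ[F] Fi) × G))
    (_hθ : ∀ γ : Fi ≃ₐ[F] Fi,
       (genericFibre (HeightOneSpectrum.valuationSubringAtPrime F w) F).map
             (Over.isoMk (θ.aut (γ, 1)) (θ.aut_comp (γ, 1))).hom ≫ (𝓜.localise w).genericIso'.hom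
         = (𝓜.localise w).genericIso'.hom ≫
             (Over.isoMk ((thickeningGalAction (L := Fi) (S.M.obj Kc)).aut γ)
               ((thickeningGalAction (L := Fi) (S.M.obj Kc)).aut_comp γ)).hom)
    (e : Fi →ₐ[F] AlgebraicClosure (w.adicCompletion F))
    (_hunit : (UnitaryGroup.isUnit_placeForm Jstar hJu w).unit ∈ glInt 2 (w.adicCompletion F))
    (_hKc : UnitaryGroup.IsHyperspecialAt ↥(maximalRealSubfield F) F (IsCMField.complexConj F) 2 Jstar Kc.1.1
      (w.under (𝓞 ↥(maximalRealSubfield F))))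
    (_hdisj : haveI : AlgebraicGeometry.IsProper (𝓜.localise w).total.hom := h𝓨.2
      ∀ (β : Fi ≃ₐ[F] Fi) (P Q : AlgPoints (S.M.obj Kc) (AlgebraicClosure (w.adicCompletion F))),
        (𝓜.localise w).geomReductionMap (thickeningLift e (S.M.obj Kc) P) =
          AlgPoints.map ((specialFibreFunctor w).map (Over.isoMk (θ.aut (β, 1)) (θ.aut_comp (β, 1))).hom :
              (𝓜.localise w).reductionAt ⟶ (𝓜.localise w).reductionAt)
            ((𝓜.localise w).geomReductionMap (thickeningLift e (S.M.obj Kc) Q)) → β = 1)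
    (𝔇 : ModuliDatum F ι₁ Jstar K₀ S hU7ₛ hJ hJu Fi Kc G 𝓜 w hw h𝓨 θ e),
    ∀ (σ : Field.absoluteGaloisGroup (w.adicCompletion F)) (_hσ : IsAbsArithFrob σ)
      (Fr₀ : AlgPoints (𝓜.localise w).reductionAt (geomResidueField w) → AlgPoints (𝓜.localise w).reductionAt (geomResidueField w)),
      (∀ (e' : Fi →ₐ[F] AlgebraicClosure (w.adicCompletion F)) (y : AlgPoints (S.M.obj Kc) (AlgebraicClosure (w.adicCompletion F))),
          Fr₀ (red₀Of S Kc 𝓜 w h𝓨 e' y) = red₀Of S Kc 𝓜 w h𝓨 e' (σ • y)) →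
      (∀ (γ : Fi ≃ₐ[F] Fi) (p : AlgPoints (𝓜.localise w).reductionAt (geomResidueField w)),
          Fr₀ (actOf S Kc 𝓜 w θ γ p) = actOf S Kc 𝓜 w θ γ (Fr₀ p)) →
      𝔇.HeartFrob →
        Nonempty (PointDictionary.{0, 0} F ι₁ Jstar K₀ S hU7ₛ hJ hJu w hw Kc
          (AlgPoints (𝓜.localise w).reductionAt (geomResidueField w)) Fr₀ (red₀Of S Kc 𝓜 w h𝓨 e))

end Summit.HodgeConjecture.HodgeConjecture.Cruxes.HLiu418.F0P6aModuliDatumDefs
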